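import Literature.AlgebraicGeometry.Motives.HypersurfaceChartAlgebra
import Literature.AlgebraicGeometry.Motives.ProjBasicOpenSubscheme
import Literature.AlgebraicGeometry.Motives.HypersurfaceJacobianPresentation
import Literature.AlgebraicGeometry.Motives.HypersurfaceFormsNonsingular
import Literature.AlgebraicGeometry.Motives.GoodReductionSpecialFibreProofs
import Literature.AlgebraicGeometry.Motives.Sweep1
import Mathlib.RingTheory.MvPolynomial.EulerIdentity
import Mathlib.RingTheory.Ideal.Quotient.Nilpotent
import HarnessLib

/-!
# The hypersurface `V₊(F) ⊆ ℙⁿ⁺¹_k` of a nonsingular form is smooth of relative dimension `n`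

For a field `k` and a homogeneous form `F ∈ k[x₀, …, x_{n+1}]` of degree `d ≥ 1` we construct the
hypersurface `X_F = V₊(F)` with its **reduced induced closed subscheme structure**
(`hypersurface F`: Mathlib's `Scheme.IdealSheafData.vanishingIdeal` of the closed set `V₊(F)` and
its `subscheme`, Hartshorne II Example 3.2.6) as a `k`-scheme with its closed immersion
`hypersurfaceι F : X_F ↪ ℙⁿ⁺¹_k` onto `V₊(F)`, and prove the **projective Jacobian criterion**
(Hartshorne I Ex. 5.8 with III Thm. 10.2): if `F` is *nonsingular* in the sense that no prime ideal
contains `F` and all its partial derivatives without containing all the variables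
(`IsNonsingularForm F`, `Motives/HypersurfaceFormsNonsingular`), then `X_F → Spec k` is smooth of
relative dimension `n`
(`smoothOfRelativeDimension_hypersurface_hom`); consequently `X_F` is reduced and
`IsHypersurfaceCutOutBy (n + 1) F X_F` holds (`isHypersurfaceCutOutBy_hypersurface`).

## Proof

* **Cover** (I Ex. 5.8(c), Euler's lemma `Σ xᵢ ∂ᵢF = d·F`, Mathlib
  `MvPolynomial.IsHomogeneous.sum_X_mul_pderiv`): `V₊(F) ⊆ ⋃_{i,j} D₊(xᵢ · ∂F/∂x_{i.succAbove j})`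
  (`exists_mem_basicOpen_of_mem_zeroLocus`).
* **Charts** (I Ex. 5.8(b), II Prop. 2.5(b)): over `D₊(xᵢ h)`, `h = ∂F/∂x_{i.succAbove j}`, the
  subscheme is `Spec (Γ(D₊(xᵢh))/𝓘) → Spec k`, `Spec` of `k → (k[x]_{xᵢh})₀/𝔍 ≅ Γ/𝓘`
  (`Motives/ProjBasicOpenSubscheme`), where `𝔍` is the radical of `(f)`, `f = F(xᵢ := 1)` read in
  `S = (k[x]_{xᵢh})₀ = k[y][1/∂ⱼf]` (`Motives/HypersurfaceChartAlgebra`).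
* **Jacobian criterion** (`Motives/HypersurfaceJacobianPresentation`): `S/(f)` is standard smooth of
  relative dimension `n`, hence reduced (`isReduced_of_isStandardSmoothOfRelativeDimension`, Stacks
  056S via Matsumura 14.3), so `(f)` is radical, `𝔍 = (f)`, and the chart is standard smooth.
* Smoothness is Zariski-local at the source (Mathlib `HasRingHomProperty`), and smooth over a field
  implies reduced (`isReduced_of_smoothOfRelativeDimension`, Stacks 056T).

## References

* R. Hartshorne, *Algebraic Geometry*, GTM 52 (1977): I Ex. 5.8, II Prop. 2.5, II Example 3.2.6,
  III §10 (10.0.3, Thm. 10.2). [Hartshorne1977]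
* The Stacks project, Tags 056S, 056T. [StacksProject]
-/

noncomputable section

open CategoryTheory AlgebraicGeometry MvPolynomial HomogeneousLocalization TopologicalSpace

universe u

namespace Literature.AlgebraicGeometry.Motives.SmoothHypersurface

open ProjectiveSpace ProjSubscheme

variable (k : Type u) [Field k] {n : ℕ}

attribute [local instance] MvPolynomial.gradedAlgebra ProjBaseChange.algebraBase
  ProjBaseChange.isScalarTower_localization

local notation "𝒜" => MvPolynomial.homogeneousSubmodule (Fin (n + 2)) k

/-! ### The cover of `V₊(F)` by the `D₊(xᵢ ∂ⱼF)` for a nonsingular form -/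

variable {k}
variable (F : MvPolynomial (Fin (n + 2)) k) {d : ℕ} (hF : F.IsHomogeneous d)

include hF in
/-- `xᵢ · ∂F/∂x_{i.succAbove j}` is homogeneous of degree `1 + (d - 1)` (Mathlib
`IsHomogeneous.pderiv`). [folklore] -/
theorem X_mul_pderiv_mem (i : Fin (n + 2)) (j : Fin (n + 1)) :
    X i * pderiv (i.succAbove j) F ∈
      MvPolynomial.homogeneousSubmodule (Fin (n + 2)) k (1 + (d - 1)) :=
  SetLike.mul_mem_graded (X_mem i) hF.pderiv

include hF in
/-- **The `D₊(xᵢ · ∂F/∂x_{i.succAbove j})` cover `V₊(F)`** for a nonsingular form `F` (Hartshorne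
I Ex. 5.8(c)): if a relevant homogeneous prime `𝔭 ∋ F` contained every `xᵢ ∂ⱼF` (`j ≠ i`), then,
`xᵢ₀ ∉ 𝔭` for some `i₀`, all `∂ⱼF`, `j ≠ i₀`, lie in `𝔭`, and so does `∂ᵢ₀F` by Euler's lemma
`Σ xⱼ ∂ⱼF = d·F` (Mathlib `IsHomogeneous.sum_X_mul_pderiv`); nonsingularity then puts every `xᵢ`
in `𝔭`, contradicting relevance. [cite: Hartshorne1977, I Ex. 5.8] -/
theorem exists_mem_basicOpen_of_mem_zeroLocus (hJ : IsNonsingularForm k F) (p : Proj 𝒜)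
    (hp : p ∈ ProjectiveSpectrum.zeroLocus 𝒜 {F}) :
    ∃ ij : Fin (n + 2) × Fin (n + 1),
      p ∈ Proj.basicOpen 𝒜 (X ij.1 * pderiv (ij.1.succAbove ij.2) F) := by
  have hFp : F ∈ p.asHomogeneousIdeal := Set.singleton_subset_iff.mp hp
  -- not all variables lie in `𝔭`
  have hXall : ¬ ∀ i, (X i : MvPolynomial (Fin (n + 2)) k) ∈ p.asHomogeneousIdeal := by
    intro h
    refine p.not_irrelevant_le fun a ha => ?_
    exact Ideal.span_le.mpr (Set.range_subset_iff.mpr h) (irrelevant_le_span (n + 1) k ha)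
  by_contra! H
  simp only [Proj.mem_basicOpen, not_not] at H
  obtain ⟨i₀, hi₀⟩ : ∃ i₀, (X i₀ : MvPolynomial (Fin (n + 2)) k) ∉ p.asHomogeneousIdeal := by
    by_contra! h
    exact hXall h
  have hsA : ∀ j : Fin (n + 1), pderiv (i₀.succAbove j) F ∈ p.asHomogeneousIdeal := fun j =>
    (p.isPrime.mem_or_mem (H ⟨i₀, j⟩)).resolve_left hi₀
  -- Euler: `x_{i₀} ∂_{i₀} F = d F - Σ_{j} x_{sA j} ∂_{sA j} F ∈ 𝔭`
  have hi₀' : pderiv i₀ F ∈ p.asHomogeneousIdeal := by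
    have heuler := hF.sum_X_mul_pderiv
    rw [Fin.sum_univ_succAbove _ i₀] at heuler
    have h1 : X i₀ * pderiv i₀ F =
        d • F - ∑ j : Fin (n + 1), X (i₀.succAbove j) * pderiv (i₀.succAbove j) F := by
      rw [← heuler]; ring
    have hmem : X i₀ * pderiv i₀ F ∈ p.asHomogeneousIdeal := by
      rw [h1]
      exact Ideal.sub_mem _ (nsmul_mem hFp d)
        (Ideal.sum_mem _ fun j _ => Ideal.mul_mem_left _ _ (hsA j))
    exact (p.isPrime.mem_or_mem hmem).resolve_left hi₀
  have hall : ∀ s, pderiv s F ∈ p.asHomogeneousIdeal := fun s => by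
    rcases Fin.eq_self_or_eq_succAbove i₀ s with rfl | ⟨j, rfl⟩
    · exact hi₀'
    · exact hsA j
  exact hXall (hJ _ p.isPrime hFp hall)

/-! ### The reduced hypersurface `V₊(F)` as a `k`-scheme -/

/-- The closed subset `V₊(F) ⊆ ℙⁿ⁺¹_k = Proj k[x₀,…,x_{n+1}]` (Mathlib `ProjectiveSpectrum.zeroLocus`).
[folklore] -/
def zeroLocusClosed : Closeds (Proj 𝒜) :=
  ⟨ProjectiveSpectrum.zeroLocus 𝒜 {F}, ProjectiveSpectrum.isClosed_zeroLocus 𝒜 _⟩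

/-- Unfolding: the underlying set of `zeroLocusClosed F` is `V₊(F)` (`rfl`). [folklore] -/
@[simp]
theorem coe_zeroLocusClosed :
    (zeroLocusClosed F : Set (Proj 𝒜)) = ProjectiveSpectrum.zeroLocus 𝒜 {F} := rfl

/-- The ideal sheaf of the **reduced induced structure** on `V₊(F)` (Mathlib
`IdealSheafData.vanishingIdeal`; Hartshorne II Example 3.2.6). [folklore] -/
def idealSheaf : (Proj 𝒜).IdealSheafData :=
  Scheme.IdealSheafData.vanishingIdeal (zeroLocusClosed F)

/-- **The hypersurface `X_F = V₊(F)`** with its reduced induced closed subscheme structure, as a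
`k`-scheme `X_F ↪ ℙⁿ⁺¹_k → Spec k` (Hartshorne II Example 3.2.6 and §4). [folklore] -/
def hypersurface : SchemeOver k :=
  Over.mk ((idealSheaf F).subschemeι ≫ (projectiveSpace (n + 1) k).hom)

/-- The closed immersion `X_F ↪ ℙⁿ⁺¹_k` over `k` (Mathlib `IdealSheafData.subschemeι`). [folklore] -/
def hypersurfaceι : hypersurface F ⟶ projectiveSpace (n + 1) k :=
  Over.homMk (idealSheaf F).subschemeι rfl

/-- `hypersurfaceι` is Mathlib's `subschemeι` on underlying schemes (`rfl`). [folklore] -/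
@[simp]
theorem hypersurfaceι_left : (hypersurfaceι F).left = (idealSheaf F).subschemeι := rfl

/-- The structure morphism of `X_F` is `X_F ↪ ℙⁿ⁺¹_k → Spec k` (`rfl`). [folklore] -/
theorem hypersurface_hom :
    (hypersurface F).hom = (idealSheaf F).subschemeι ≫ ProjBaseChange.projToSpec (Fin (n + 2)) k :=
  rfl

/-- `X_F ↪ ℙⁿ⁺¹_k` is a closed immersion (Mathlib's instance for `subschemeι`). [folklore] -/
instance isClosedImmersion_hypersurfaceι_left : IsClosedImmersion (hypersurfaceι F).left :=
  inferInstanceAs (IsClosedImmersion (idealSheaf F).subschemeι)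

/-- The image of `X_F ↪ ℙⁿ⁺¹_k` is `V₊(F)` (Mathlib `range_subschemeι`, support of the vanishing ideal
sheaf). [folklore] -/
theorem range_hypersurfaceι :
    Set.range (hypersurfaceι F).left = ProjectiveSpectrum.zeroLocus 𝒜 {F} := by
  refine (Scheme.IdealSheafData.range_subschemeι (idealSheaf F)).trans ?_
  rw [idealSheaf, Scheme.IdealSheafData.coe_support_vanishingIdeal]
  rfl

/-- `X_F` is projective over `k` (it comes with the closed `k`-immersion `hypersurfaceι`).
[folklore] -/
theorem isProjectiveOver_hypersurface : IsProjectiveOver (hypersurface F) :=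
  ⟨n + 1, hypersurfaceι F, inferInstance⟩

/-! ### The charts `X_F ∩ D₊(xᵢ ∂ⱼF)` are standard smooth -/

section Chart

variable (i : Fin (n + 2)) (j : Fin (n + 1))

/-- `0 < 1 + (d - 1)`, the degree of `xᵢ · ∂F/∂xⱼ`. [folklore] -/
theorem one_add_pos (d : ℕ) : 0 < 1 + (d - 1) := by omega

/-- The affine open `D₊(xᵢ · ∂F/∂x_{i.succAbove j}) ⊆ ℙⁿ⁺¹_k` (`ProjSubscheme.affineBasicOpen`).
[folklore] -/
abbrev chartOpen : (Proj 𝒜).affineOpens :=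
  affineBasicOpen 𝒜 (X i * pderiv (i.succAbove j) F) (X_mul_pderiv_mem F hF i j) (one_add_pos d)

/-- The chart algebra `S = (k[x]_{xᵢ h})₀`, `h = ∂F/∂x_{i.succAbove j}`. -/
local notation "S" => Away 𝒜 (X i * pderiv (i.succAbove j) F)

/-- The dehomogenised equation `f = F(xᵢ := 1)` of `X_F` on `D₊(xᵢ)`, read in `S` through the chart
map (`chartMap`). -/
local notation "fS" => chartMap k i (hF.pderiv (i := i.succAbove j)) (dehomogenize k i F)

/-- On `D₊(xᵢ h)`, `h = ∂F/∂x_{i.succAbove j}`: the ideal of the reduced structure on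
`V₊(F) ∩ D₊(xᵢh)`, read in `S = (k[x]_{xᵢh})₀` through `S ≅ Γ(D₊(xᵢh))`, is the **radical of the
principal ideal `(f)`**, `f = F(xᵢ := 1)` read in `S` (II Example 3.2.6 with I Ex. 5.8(b):
`V₊(F) ∩ D₊(xᵢh) = V(f)`, `Motives/ProjBasicOpenSubscheme.awayι_mul_preimage_zeroLocus`).
[folklore] -/
theorem ideal_chartOpen_eq_map_radical (hd : 0 < d) :
    (idealSheaf F).ideal (chartOpen F hF i j) =
      Ideal.map (Proj.awayToSection 𝒜 (X i * pderiv (i.succAbove j) F)).hom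
        (Ideal.span {fS}).radical := by
  rw [idealSheaf, vanishingIdeal_ideal_affineBasicOpen]
  congr 1
  rw [coe_zeroLocusClosed]
  refine (congrArg PrimeSpectrum.vanishingIdeal
    (awayι_mul_preimage_zeroLocus 𝒜 (X_mem i) Nat.one_pos hF.pderiv rfl hF hd)).trans ?_
  rw [← chartMap_dehomogenize k i _ F hF, ← PrimeSpectrum.zeroLocus_span,
    PrimeSpectrum.vanishingIdeal_zeroLocus_eq_radical]

/-- **Jacobian criterion on the chart**: `S/(f)` is standard smooth of relative dimension `n` over
`k` (`Motives/HypersurfaceJacobianPresentation`, as `S = k[y][1/∂ⱼf]` by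
`Motives/HypersurfaceChartAlgebra.isLocalization_chartMap` and `∂ⱼf = (∂F/∂x_{i.succAbove j})(xᵢ:=1)`),
Hartshorne I Ex. 5.8(b) with III Thm. 10.2. [cite: Hartshorne1977, I Ex. 5.8 and III Thm. 10.2] -/
theorem isStandardSmoothOfRelativeDimension_chart :
    Algebra.IsStandardSmoothOfRelativeDimension n k (S ⧸ Ideal.span {fS}) := by
  letI : Algebra (MvPolynomial (Fin (n + 1)) k) S :=
    (chartMap k i (hF.pderiv (i := i.succAbove j))).toRingHom.toAlgebra
  haveI : IsScalarTower k (MvPolynomial (Fin (n + 1)) k) S :=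
    IsScalarTower.of_algebraMap_eq fun r =>
      ((chartMap k i (hF.pderiv (i := i.succAbove j))).commutes r).symm
  haveI : IsLocalization.Away (pderiv j (dehomogenize k i F)) S := by
    rw [pderiv_dehomogenize]
    exact isLocalization_chartMap k i (hF.pderiv (i := i.succAbove j))
  exact isStandardSmoothOfRelativeDimension_quotient (dehomogenize k i F) j S

/-- Hence `S/(f)` is reduced (smooth over a field ⇒ reduced, Stacks 056S/056T via Matsumura 14.3,
`isReduced_of_isStandardSmoothOfRelativeDimension`) and `(f)` is a radical ideal of `S`.
[cite: StacksProject, Tag 056T] -/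
theorem radical_span_chart_eq : (Ideal.span {fS}).radical = Ideal.span {fS} := by
  haveI := isStandardSmoothOfRelativeDimension_chart F hF i j
  haveI : IsReduced (S ⧸ Ideal.span {fS}) := isReduced_of_isStandardSmoothOfRelativeDimension k n
  exact Ideal.radical_eq_iff.mpr ((Ideal.isRadical_iff_quotient_reduced _).mpr this)

/-- **`X_F` on the chart is `f = 0`**: the ideal of the reduced structure on `V₊(F) ∩ D₊(xᵢh)` is the
principal ideal `(f)` itself (read through `S ≅ Γ(D₊(xᵢh))`). [folklore] -/
theorem ideal_chartOpen_eq (hd : 0 < d) :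
    (idealSheaf F).ideal (chartOpen F hF i j) =
      Ideal.map (Proj.awayToSection 𝒜 (X i * pderiv (i.succAbove j) F)).hom (Ideal.span {fS}) := by
  rw [ideal_chartOpen_eq_map_radical F hF i j hd, radical_span_chart_eq F hF i j]

/-- The ring map `k → S ≅ Γ(D₊(xᵢh)) → Γ(D₊(xᵢh))/𝓘` whose `Spec` is the structure morphism of the
chart of `X_F` over `D₊(xᵢh)`. [folklore] -/
def chartRingHom : k →+* (Γ(Proj 𝒜, (chartOpen F hF i j : (Proj 𝒜).Opens)) ⧸
    (idealSheaf F).ideal (chartOpen F hF i j)) :=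
  (Ideal.Quotient.mk _).comp
    ((Proj.awayToSection 𝒜 (X i * pderiv (i.succAbove j) F)).hom.comp (algebraMap k S))

/-- The structure morphism of the chart `Spec (Γ(D₊(xᵢh))/𝓘) → X_F → Spec k` is `Spec` of
`chartRingHom` (`Motives/ProjBasicOpenSubscheme.subschemePiece_ι_toSpecZero`). [folklore] -/
theorem subschemePiece_hom :
    subschemePiece (idealSheaf F) (chartOpen F hF i j) ≫
        ((idealSheaf F).subschemeι ≫ ProjBaseChange.projToSpec (Fin (n + 2)) k) =
      Spec.map (CommRingCat.ofHom (chartRingHom F hF i j)) := by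
  rw [reassoc_of% subschemePiece_ι_toSpecZero 𝒜 (X i * pderiv (i.succAbove j) F)
    (X_mul_pderiv_mem F hF i j) (one_add_pos d) (idealSheaf F), ← Spec.map_comp]
  rfl

/-- `chartRingHom` is, up to the isomorphism `S/(f) ≅ Γ(D₊(xᵢh))/𝓘` induced by
`S ≅ Γ(D₊(xᵢh))` (Mathlib `Ideal.quotientEquiv`), the structure map `k → S/(f)`; hence it is
standard smooth of relative dimension `n`. [cite: Hartshorne1977, I Ex. 5.8 and III Thm. 10.2] -/
theorem isStandardSmoothOfRelativeDimension_chartRingHom (hd : 0 < d) :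
    (chartRingHom F hF i j).IsStandardSmoothOfRelativeDimension n := by
  let e : S ≃+* Γ(Proj 𝒜, (chartOpen F hF i j : (Proj 𝒜).Opens)) :=
    (Proj.basicOpenIsoAway 𝒜 (X i * pderiv (i.succAbove j) F) (X_mul_pderiv_mem F hF i j)
      (one_add_pos d)).commRingCatIsoToRingEquiv
  have hIJ : (idealSheaf F).ideal (chartOpen F hF i j) =
      Ideal.map (e : S →+* _) (Ideal.span {fS}) := by
    rw [ideal_chartOpen_eq F hF i j hd]
    rfl
  let E := Ideal.quotientEquiv _ _ e hIJ
  haveI := isStandardSmoothOfRelativeDimension_chart F hF i j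
  have hQ : (algebraMap k (S ⧸ Ideal.span {fS})).IsStandardSmoothOfRelativeDimension n :=
    (RingHom.isStandardSmoothOfRelativeDimension_algebraMap n).mpr inferInstance
  have hcomp : chartRingHom F hF i j = E.toRingHom.comp (algebraMap k (S ⧸ Ideal.span {fS})) :=
    RingHom.ext fun r => rfl
  rw [hcomp]
  exact RingHom.isStandardSmoothOfRelativeDimension_respectsIso.1 _ E hQ

/-- **The chart of `X_F` over `D₊(xᵢ ∂ⱼF)` is smooth of relative dimension `n` over `k`.**
[cite: Hartshorne1977, I Ex. 5.8 and III Thm. 10.2] -/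
theorem smoothOfRelativeDimension_subschemePiece (hd : 0 < d) :
    SmoothOfRelativeDimension n (subschemePiece (idealSheaf F) (chartOpen F hF i j) ≫
      ((idealSheaf F).subschemeι ≫ ProjBaseChange.projToSpec (Fin (n + 2)) k)) := by
  rw [subschemePiece_hom, HasRingHomProperty.Spec_iff (P := @SmoothOfRelativeDimension n)]
  exact RingHom.locally_of RingHom.isStandardSmoothOfRelativeDimension_respectsIso _
    (isStandardSmoothOfRelativeDimension_chartRingHom F hF i j hd)

end Chart

/-! ### Smoothness, reducedness, and the cut-out predicate -/

include hF in
/-- **Projective Jacobian criterion** (Hartshorne I Ex. 5.8, III Thm. 10.2 / 10.0.3): for a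
nonsingular form `F` of degree `d ≥ 1`, the reduced hypersurface `X_F = V₊(F) → Spec k` is smooth of
relative dimension `n` (smoothness is Zariski-local at the source; the charts over the cover
`D₊(xᵢ ∂ⱼF)` are standard smooth). [cite: Hartshorne1977, I Ex. 5.8 and III Thm. 10.2] -/
theorem smoothOfRelativeDimension_subschemeι_projToSpec (hJ : IsNonsingularForm k F) (hd : 0 < d) :
    SmoothOfRelativeDimension n
      ((idealSheaf F).subschemeι ≫ ProjBaseChange.projToSpec (Fin (n + 2)) k) := by
  let 𝒱 : (idealSheaf F).subscheme.OpenCover :=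
    Scheme.Cover.mkOfCovers (Fin (n + 2) × Fin (n + 1))
      (fun ij => Spec (CommRingCat.of (Γ(Proj 𝒜, (chartOpen F hF ij.1 ij.2 : (Proj 𝒜).Opens)) ⧸
        (idealSheaf F).ideal (chartOpen F hF ij.1 ij.2))))
      (fun ij => subschemePiece (idealSheaf F) (chartOpen F hF ij.1 ij.2)) (fun x => by
        obtain ⟨ij, hij⟩ := exists_mem_basicOpen_of_mem_zeroLocus F hF hJ ((idealSheaf F).subschemeι x)
          (by
            rw [← range_hypersurfaceι F]
            exact ⟨x, rfl⟩)
        have hx : x ∈ (subschemePiece (idealSheaf F) (chartOpen F hF ij.1 ij.2)).opensRange := by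
          rw [opensRange_subschemePiece]
          exact hij
        obtain ⟨y, hy⟩ := hx
        exact ⟨ij, y, hy⟩)
  exact IsZariskiLocalAtSource.of_openCover (P := @SmoothOfRelativeDimension n) 𝒱 fun ij =>
    smoothOfRelativeDimension_subschemePiece F hF ij.1 ij.2 hd

include hF in
/-- The structure morphism `X_F → Spec k` is smooth of relative dimension `n` (restatement of
`smoothOfRelativeDimension_subschemeι_projToSpec` for the `k`-scheme `hypersurface F`).
[cite: Hartshorne1977, I Ex. 5.8 and III Thm. 10.2] -/
theorem smoothOfRelativeDimension_hypersurface_hom (hJ : IsNonsingularForm k F) (hd : 0 < d) :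
    SmoothOfRelativeDimension n (hypersurface F).hom :=
  smoothOfRelativeDimension_subschemeι_projToSpec F hF hJ hd

include hF in
/-- `X_F` is reduced (smooth over a field, `isReduced_of_smoothOfRelativeDimension`, Stacks 056T;
equivalently: by construction, as a reduced induced subscheme). [cite: StacksProject, Tag 056T] -/
theorem isReduced_hypersurface (hJ : IsNonsingularForm k F) (hd : 0 < d) :
    IsReduced (hypersurface F).left :=
  @isReduced_of_smoothOfRelativeDimension k _ (idealSheaf F).subscheme
    ((idealSheaf F).subschemeι ≫ ProjBaseChange.projToSpec (Fin (n + 2)) k) n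
    (smoothOfRelativeDimension_subschemeι_projToSpec F hF hJ hd)

include hF in
/-- `X_F` is the reduced closed subscheme of `ℙⁿ⁺¹_k` cut out set-theoretically by `F`
(`IsHypersurfaceCutOutBy (n + 1) F X_F` of `Motives/Sweep1`). [folklore] -/
theorem isHypersurfaceCutOutBy_hypersurface (hJ : IsNonsingularForm k F) (hd : 0 < d) :
    IsHypersurfaceCutOutBy (n + 1) F (hypersurface F) :=
  ⟨isReduced_hypersurface F hF hJ hd, hypersurfaceι F, inferInstance, range_hypersurfaceι F⟩

end Literature.AlgebraicGeometry.Motives.SmoothHypersurface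

end
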